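import Literature.NumberTheory.EllipticCurves.HidaOrdinaryCohomologyEichlerShimura
import Literature.NumberTheory.EllipticCurves.HidaFamilyMembersRankMonotoneProofs
import HarnessLib

/-!
# The deep half of Hida's rank constancy, `ord_k(Γ₀(Np)) ≤ ord_2(Γ₀(Np))`, and
# `hida_exists_congruent_ordinary_newform` from the Modularity Theorem

Final file of the cohomological proof (files `HidaOrdinaryCohomologySymPow`, `…Cocycles`,
`…Lattice`, `…Parabolic`, `…EichlerShimura`) of the inequality

  `#{unit U_p-eigenvalues on S_k(Γ₀(Np))} ≤ #{unit U_p-eigenvalues on S_2(Γ₀(Np))}`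

(`p ≥ 5`, `p ∤ N`, `k ≥ 2`, `k ≡ 2 mod p - 1`, unit = `p`-adic unit under `ι : ℚ̄_p ≃ ℂ`, counted
with multiplicity), `finrank_ordinary_le_two` — the deep half of Hida's theorem that the rank
of the ordinary part is independent of the weight [Hida 1986 (Invent.), Thm. 3.1 / (ENS) Cor. 7.2;
EMI Cor. 4.2.32].  Argument (EMI §4.2.11, made elementary): with `𝒪` the valuation ring of `ι`
and `𝕜` its residue field,

* `ord_k(ι) + ord_k(ῑ) = dim V̄_k - dim E₀(U_p | V̄_k)` where `V̄_k ⊆ (Γ₀(Np) → Symⁿ 𝕜²)` is the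
  reduction of an integral `U_p`-stable lattice in the span of the Eichler–Shimura cocycles of
  `S_k` and their conjugates (`exists_span_count`: real injectivity of Eichler–Shimura, exact
  Hecke compatibility, decomposition numbers);
* `V̄_k` consists of cocycles whose `uⁿ`-coefficient is an additive map vanishing on the parabolic
  elements above the cusp `∞` of `X₀(p)` (parabolicity of cusp-form cocycles, reduced mod `𝔪`),
  so Hida's contraction `I⁻¹ U` and the key lemma `U(infSp) ⊆ parSp` give
  `dim V̄_k - dim E₀ ≤ dim parSp - dim E₀(U_p | parSp)` (`finrank_sub_le_parSp_of_proj0`);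
* at weight `2`, `V̄_2 ⊆ parSp` has dimension `2 dim S_2 ≥ dim parSp` (Mazur's count,
  `finrank_parSp_le`), so `V̄_2 = parSp` and the right side is `ord_2(ι) + ord_2(ῑ)`;
* the elementary half `ord_2 ≤ ord_k` for `ι` and for `ῑ = ι ∘ conj`
  (`HidaRank.hida_ordinary_rank_two_le`) turns `ord_k(ι) + ord_k(ῑ) ≤ ord_2(ι) + ord_2(ῑ)` into
  `ord_k(ι) ≤ ord_2(ι)`.

Consequently (`hida_exists_congruent_ordinary_newform_of_exists_isNewformOf`) the named fact
`hida_exists_congruent_ordinary_newform` follows from the Modularity Theorem alone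
(`exists_isNewformOf`, the only remaining hypothesis; no `_holds` is claimed for it here).

## References

* H. Hida, *Galois representations into GL₂(ℤ_p[[X]]) attached to ordinary cusp forms*,
  Invent. Math. 85 (1986), §3, Thm. 3.1. [Hida1986]
* H. Hida, *Iwasawa modules attached to congruences of cusp forms*, Ann. Sci. ÉNS 19 (1986),
  §4 (Prop. 4.7), §7 (Cor. 7.2). [Hida1986ENS]
* H. Hida, *Elementary Modular Iwasawa Theory*, World Scientific 2022, Lemma 4.1.25, §4.2.11,
  Cor. 4.2.32. [Hida2022EMI]
* G. Shimura, *Introduction to the arithmetic theory of automorphic functions* (1971), Ch. 8.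
  [Shimura1971]
-/

noncomputable section

open scoped MatrixGroups ModularForm ComplexConjugate
open CongruenceSubgroup Matrix Module Module.End IsLocalRing

namespace Literature.NumberTheory.EllipticCurves.ModularForms.HidaCohomology

/-! ### The valuation ring of `ι` and its residue field -/

section Residue

variable {p : ℕ} [Fact p.Prime] (ι : PadicAlgCl p ≃+* ℂ) {O : ValuationSubring ℂ}
  (hO : ∀ x, x ∈ O ↔ ‖ι.symm x‖ ≤ 1)
include hO

/-- Residual units of `𝒪_ι` are the `ι`-units. [folklore] -/
theorem isResUnit_iff_norm (z : ℂ) : IsResUnit O z ↔ ‖ι.symm z‖ = 1 := by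
  constructor
  · rintro ⟨a, rfl, ha⟩
    exact (HidaRank.residue_ne_zero_iff_norm ι hO a).mp ha
  · intro hz
    exact ⟨⟨z, (hO z).mpr hz.le⟩, rfl, (HidaRank.residue_ne_zero_iff_norm ι hO _).mpr hz⟩

/-- `p = 0` in the residue field of `𝒪_ι`. [folklore] -/
theorem natCast_p_residueField : (p : ResidueField O) = 0 := by
  have hmem : ((p : ℕ) : O) ∈ maximalIdeal O := by
    rw [HidaRank.mem_maximalIdeal_iff_norm ι hO]
    push_cast
    rw [map_natCast]
    exact Automorphic.PadicAlgCl.norm_natCast_p_lt_one p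
  rw [← map_natCast (residue O), residue_eq_zero_iff]
  exact hmem

/-- The residue field of `𝒪_ι` has characteristic `p`. [folklore] -/
theorem charP_residueField : CharP (ResidueField O) p :=
  (CharP.charP_iff_prime_eq_zero Fact.out).mpr (natCast_p_residueField ι hO)

/-- An integer prime to `p` is non-zero in the residue field. [folklore] -/
theorem intCast_residueField_ne_zero {m : ℤ} (hm : ¬ (p : ℤ) ∣ m) : (m : ResidueField O) ≠ 0 := by
  haveI := charP_residueField ι hO
  rwa [Ne, CharP.intCast_eq_zero_iff (ResidueField O) p]

/-- An integer divisible by `p` vanishes in the residue field. [folklore] -/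
theorem intCast_residueField_eq_zero {m : ℤ} (hm : (p : ℤ) ∣ m) : (m : ResidueField O) = 0 := by
  haveI := charP_residueField ι hO
  rwa [CharP.intCast_eq_zero_iff (ResidueField O) p]

end Residue

/-! ### Complex conjugate of `ι` -/

section Conj

/-- Complex conjugation as a ring automorphism of `ℂ`. [folklore] -/
def conjEquiv : ℂ ≃+* ℂ :=
  RingEquiv.ofRingHom (starRingEnd ℂ) (starRingEnd ℂ) (by ext z; simp) (by ext z; simp)

/-- Unfolding `conjEquiv.symm`. [folklore] -/
@[simp] theorem conjEquiv_symm_apply (z : ℂ) : conjEquiv.symm z = conj z := rfl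

variable {p : ℕ} [Fact p.Prime]

/-- **The conjugate embedding** `ῑ := conj ∘ ι`. [folklore] -/
def conjι (ι : PadicAlgCl p ≃+* ℂ) : PadicAlgCl p ≃+* ℂ := ι.trans conjEquiv

/-- `ῑ⁻¹ z = ι⁻¹ (conj z)`. [folklore] -/
@[simp] theorem conjι_symm_apply (ι : PadicAlgCl p ≃+* ℂ) (z : ℂ) :
    (conjι ι).symm z = ι.symm (conj z) := by
  rw [conjι, RingEquiv.symm_trans_apply, conjEquiv_symm_apply]

end Conj

/-! ### Root counts -/

section Roots

/-- Roots of the conjugate polynomial. [folklore] -/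
theorem roots_map_conj (P : Polynomial ℂ) :
    (P.map (starRingEnd ℂ)).roots = P.roots.map (starRingEnd ℂ) :=
  (IsAlgClosed.splits P).roots_map_of_injective (RingHom.injective _)

open scoped Classical in
/-- Counting the roots of `P · conj P` with a property. [folklore] -/
theorem card_filter_roots_mul_conj (P : Polynomial ℂ) (hP : P ≠ 0) (Q : ℂ → Prop) :
    ((P * P.map (starRingEnd ℂ)).roots.filter Q).card =
      (P.roots.filter Q).card + (P.roots.filter fun u ↦ Q (conj u)).card := by
  have hP' : P.map (starRingEnd ℂ) ≠ 0 := by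
    rwa [Ne, Polynomial.map_eq_zero_iff (RingHom.injective _)]
  rw [Polynomial.roots_mul (mul_ne_zero hP hP'), Multiset.filter_add, Multiset.card_add,
    roots_map_conj, Multiset.filter_map, Multiset.card_map]
  congr 2

end Roots

/-! ### The count at one weight -/

section Count

variable {p : ℕ} [Fact p.Prime] (ι : PadicAlgCl p ≃+* ℂ) {O : ValuationSubring ℂ}
  (hO : ∀ x, x ∈ O ↔ ‖ι.symm x‖ ≤ 1)

/-- `NeZero p` from primality. [folklore] -/
instance neZero_of_fact_prime : NeZero p := ⟨(Fact.out : p.Prime).ne_zero⟩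

include hO in
/-- **The count at weight `n + 2`.**  For `p ∣ N`, `n` even, there is a finite-dimensional
`U_p`-stable subspace `V̄ ⊆ (Γ₀(N) → Symⁿ 𝕜²)` of cocycles, all vanishing as forms on the integral
eigenvectors of the parabolic elements, with `dim V̄ = 2 dim S_{n+2}(Γ₀(N))` and
`dim V̄ - dim E₀(U_p | V̄) = ord_{n+2}(ι) + ord_{n+2}(ῑ)`. [cite: Hida2022EMI, §4.2.11 and Cor. 4.2.32]
[cite: Shimura1971, Thm. 8.4] -/
theorem exists_span_count {N : ℕ} [NeZero N] {n : ℕ} (hn : Even n) :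
    ∃ (V : Submodule (ResidueField O) (Gamma0 N → Fin (n + 1) → ResidueField O))
      (_ : FiniteDimensional (ResidueField O) V)
      (hV : ∀ x ∈ V, heckeU n N (ResidueField O) (Fact.out : p.Prime) x ∈ V),
      V ≤ cocycles n N (ResidueField O) ∧
      (∀ x ∈ V, ∀ (Q : Gamma0 N) (v : Fin 2 → ℤ), IsEigenElt Q v →
        evalVec n (x Q) (fun j ↦ ((v j : ℤ) : ResidueField O)) = 0) ∧
      finrank (ResidueField O) V = finrank ℂ (CuspForm (Gamma0 N) (n + 2)) +
        finrank ℂ (CuspForm (Gamma0 N) (n + 2)) ∧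
      finrank (ResidueField O) V - finrank (ResidueField O)
          ↥(maxGenEigenspace ((heckeU n N (ResidueField O) (Fact.out : p.Prime)).restrict hV) 0) =
        finrank ℂ ↥(⨆ (u : ℂ) (_ : ‖ι.symm u‖ = 1),
            (heckeT (Gamma0 N) (n + 2) p).maxGenEigenspace u) +
          finrank ℂ ↥(⨆ (u : ℂ) (_ : ‖(conjι ι).symm u‖ = 1),
            (heckeT (Gamma0 N) (n + 2) p).maxGenEigenspace u) := by
  classical
  have hp : p.Prime := Fact.out
  haveI : FiniteDimensional ℂ (CuspForm (Gamma0 N) (n + 2)) := finiteDimensional_cuspForm_gamma0 N _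
  set 𝕜 := ResidueField O
  set d := finrank ℂ (CuspForm (Gamma0 N) (n + 2)) with hd
  let bS : Module.Basis (Fin d) ℂ (CuspForm (Gamma0 N) (n + 2)) := Module.finBasis ℂ _
  -- the Eichler–Shimura family and its integral structure
  obtain ⟨b, M, hbK, hli, hM, hcount⟩ := exists_reduction_count O hp (esFamily' bS)
    (linearIndependent_esFamily' hn bS) (esMatrix n N p bS) (heckeUZ_esFamily' hp bS)
  -- the reduced family, as functions
  set bv : Fin (d + d) → (Gamma0 N → Fin (n + 1) → 𝕜) :=
    fun a ↦ ((mapCocycles n N (residue O) (b a) : cocycles n N 𝕜) : Gamma0 N → Fin (n + 1) → 𝕜)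
    with hbv
  have hbv_li : LinearIndependent 𝕜 bv :=
    (hli.map' (cocycles n N 𝕜).subtype (Submodule.ker_subtype _))
  have hbvM : ∀ j, heckeU n N 𝕜 hp (bv j) = ∑ i, (M.map (residue O)) i j • bv i := by
    intro j
    have := congrArg Subtype.val (hM j)
    rw [coe_heckeUZ, Submodule.coe_sum] at this
    simpa only [Submodule.coe_smul] using this
  have hV : ∀ x ∈ Submodule.span 𝕜 (Set.range bv), heckeU n N 𝕜 hp x ∈ Submodule.span 𝕜 (Set.range bv) :=
    mapsTo_span_of_family bv _ _ hbvM
  haveI : FiniteDimensional 𝕜 (Submodule.span 𝕜 (Set.range bv)) :=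
    FiniteDimensional.span_of_finite 𝕜 (Set.finite_range bv)
  refine ⟨Submodule.span 𝕜 (Set.range bv), inferInstance, hV, ?_, ?_, ?_, ?_⟩
  · -- cocycles
    rw [Submodule.span_le]
    rintro _ ⟨a, rfl⟩
    exact (mapCocycles n N (residue O) (b a)).2
  · -- parabolicity, reduced
    intro x hx Q v hQ
    induction hx using Submodule.span_induction with
    | mem u hu =>
      obtain ⟨a, rfl⟩ := hu
      -- over `ℂ`
      have hC : evalVec n (((mapCocycles n N O.subtype (b a) : cocycles n N ℂ) :
          Gamma0 N → Fin (n + 1) → ℂ) Q) (fun j ↦ (v j : ℂ)) = 0 :=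
        evalVec_eq_zero_of_mem_span hn bS (hbK a) hQ
      -- over `O`
      have hOv : evalVec n (((b a : cocycles n N O) : Gamma0 N → Fin (n + 1) → O) Q)
          (fun j ↦ ((v j : ℤ) : O)) = 0 := by
        have h1 := map_evalVec O.subtype (((b a : cocycles n N O) : Gamma0 N → Fin (n + 1) → O) Q)
          (fun j ↦ ((v j : ℤ) : O))
        have h2 : (⇑O.subtype ∘ fun j ↦ ((v j : ℤ) : O)) = fun j ↦ ((v j : ℤ) : ℂ) := by
          funext j; simp
        rw [h2] at h1
        change evalVec n (⇑O.subtype ∘ (((b a : cocycles n N O) : Gamma0 N → Fin (n + 1) → O) Q))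
          (fun j ↦ ((v j : ℤ) : ℂ)) = 0 at hC
        rw [← h1] at hC
        exact (map_eq_zero_iff O.subtype Subtype.val_injective).mp hC
      -- over `𝕜`
      have h3 := map_evalVec (residue O) (((b a : cocycles n N O) : Gamma0 N → Fin (n + 1) → O) Q)
        (fun j ↦ ((v j : ℤ) : O))
      rw [hOv, map_zero] at h3
      have h4 : (⇑(residue O) ∘ fun j ↦ ((v j : ℤ) : O)) = fun j ↦ ((v j : ℤ) : 𝕜) := by
        funext j; simp
      rw [h4] at h3
      exact h3.symm
    | zero => simp
    | add x y _ _ hx hy => rw [Pi.add_apply, evalVec_add, hx, hy, add_zero]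
    | smul c x _ hx => rw [Pi.smul_apply, evalVec_smul, hx, mul_zero]
  · rw [finrank_span_eq_card hbv_li, Fintype.card_fin]
  · rw [finrank_span_sub_finrank_maxGenEigenspace_eq hbv_li _ _ hbvM hV]
    have hc : (d + d) - (M.map (residue O)).charpoly.rootMultiplicity 0 =
        ((esMatrix n N p bS).charpoly.roots.filter (IsResUnit O)).card := by omega
    rw [hc, charpoly_esMatrix, card_filter_roots_mul_conj _ (LinearMap.charpoly_monic _).ne_zero,
      finrank_biSup_maxGenEigenspace_eq_card_roots, finrank_biSup_maxGenEigenspace_eq_card_roots]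
    congr 1
    · exact congrArg _ (Multiset.filter_congr fun u _ ↦ isResUnit_iff_norm ι hO u)
    · exact congrArg _ (Multiset.filter_congr fun u _ ↦ by rw [isResUnit_iff_norm ι hO, conjι_symm_apply])

end Count

/-! ### The hard inequality -/

section Hard

variable {p : ℕ} [Fact p.Prime]

/-- **`ord_{n+2}(ι) + ord_{n+2}(ῑ) ≤ ord_2(ι) + ord_2(ῑ)`** at level `N` with `p ∣ N` (`p ≥ 5`,
`n` even, `(p - 1) ∣ n`): the two counts are `dim V̄ - dim E₀(U_p | V̄)` at the two weights
(`exists_span_count`); at weight `n + 2` the `uⁿ`-coefficients of `V̄` lie in `infSp`, so Hida's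
contraction bounds the count by `dim parSp - dim E₀(U_p | parSp)` (`finrank_sub_le_parSp_of_proj0`),
and at weight `2`, `V̄ = parSp` by Mazur's count (`finrank_parSp_le`).
[cite: Hida2022EMI, §4.2.11, Cor. 4.2.32] [cite: Hida1986, Thm. 3.1] -/
theorem ord_add_ord_le (ι : PadicAlgCl p ≃+* ℂ) (N : ℕ) [NeZero N] (hpN : p ∣ N) (hp5 : 5 ≤ p)
    {n : ℕ} (hn : Even n) (hpn : (p - 1) ∣ n) :
    finrank ℂ ↥(⨆ (u : ℂ) (_ : ‖ι.symm u‖ = 1), (heckeT (Gamma0 N) (n + 2) p).maxGenEigenspace u) +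
        finrank ℂ ↥(⨆ (u : ℂ) (_ : ‖(conjι ι).symm u‖ = 1),
          (heckeT (Gamma0 N) (n + 2) p).maxGenEigenspace u) ≤
      finrank ℂ ↥(⨆ (u : ℂ) (_ : ‖ι.symm u‖ = 1), (heckeT (Gamma0 N) 2 p).maxGenEigenspace u) +
        finrank ℂ ↥(⨆ (u : ℂ) (_ : ‖(conjι ι).symm u‖ = 1),
          (heckeT (Gamma0 N) 2 p).maxGenEigenspace u) := by
  classical
  have hp : p.Prime := Fact.out
  obtain ⟨O, hO⟩ := HidaRank.exists_valuationSubring_norm ι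
  have hpK : (p : ResidueField O) = 0 := natCast_p_residueField ι hO
  have hp2 : p ≠ 2 := by omega
  have h2 : (2 : ResidueField O) ≠ 0 := by
    have := intCast_residueField_ne_zero ι hO (m := 2)
      (fun h ↦ by have := Int.le_of_dvd two_pos h; omega)
    exact_mod_cast this
  have h3 : (3 : ResidueField O) ≠ 0 := by
    have := intCast_residueField_ne_zero ι hO (m := 3)
      (fun h ↦ by have := Int.le_of_dvd three_pos h; omega)
    exact_mod_cast this
  -- weight `n + 2`
  obtain ⟨V, _, hV, hVc, hVpar, -, hVcount⟩ := exists_span_count ι hO (N := N) hn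
  have hVinf : ∀ x ∈ V, proj0 n N (ResidueField O) x ∈ infSp N p (ResidueField O) := by
    intro x hx
    refine ⟨fun γ δ ↦ ?_, ?_⟩
    · have h := (mem_cocycles_iff.mp (proj_mem hp hpK hpN hpn ⟨x, hVc hx⟩)) γ δ
      rw [act_zero_eq_id, LinearMap.id_apply] at h
      have h' := congr_fun h 0
      simp only [Pi.add_apply] at h'
      funext k
      simp only [proj0_apply, Pi.add_apply]
      exact h'
    · rintro Q ⟨v, hQ, hv1, hv0⟩
      funext k
      rw [proj0_apply, Pi.zero_apply]
      have h := hVpar x hx Q v hQ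
      rw [evalVec_of_apply_one_eq_zero _ (show (fun j ↦ ((v j : ℤ) : ResidueField O)) 1 = 0 from
        intCast_residueField_eq_zero ι hO hv1)] at h
      exact (mul_eq_zero.mp h).resolve_right
        (pow_ne_zero _ (intCast_residueField_ne_zero ι hO hv0))
  have hle := finrank_sub_le_parSp_of_proj0 hp hpK hp2 hpN V hV hVinf
  -- weight `2`
  obtain ⟨V₂, _, hV₂, hV₂c, hV₂par, hV₂d, hV₂count⟩ := exists_span_count ι hO (N := N) (n := 0) ⟨0, rfl⟩
  have hV₂le : V₂ ≤ parSp N (ResidueField O) := by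
    intro x hx
    refine ⟨fun γ δ ↦ ?_, ?_⟩
    · have h := (mem_cocycles_iff.mp (hV₂c hx)) γ δ
      rwa [act_zero_eq_id, LinearMap.id_apply] at h
    · rintro Q ⟨v, hQ⟩
      have h := hV₂par x hx Q v hQ
      simp only [evalVec, Fin.sum_univ_succ, Finset.univ_eq_empty, Finset.sum_empty, add_zero,
        Fin.val_zero, Nat.sub_zero, pow_zero, mul_one] at h
      funext k
      obtain ⟨k, hk⟩ := k
      obtain rfl : k = 0 := by omega
      exact h
  have hdim2 : finrank ℂ (CuspForm (Gamma0 N) ((0 : ℕ) + 2 : ℤ)) = finrank ℂ (CuspForm (Gamma0 N) 2) :=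
    congrArg (fun k : ℤ ↦ finrank ℂ (CuspForm (Gamma0 N) k)) (by norm_num)
  have hV₂eq : V₂ = parSp N (ResidueField O) := by
    have hM := finrank_parSp_le (N := N) h2 h3
    have hfin : finrank (ResidueField O) ↥(parSp N (ResidueField O)) ≤ finrank (ResidueField O) ↥V₂ := by
      rw [hV₂d]; omega
    exact Submodule.eq_of_le_of_finrank_le hV₂le hfin
  subst hV₂eq
  have hR : finrank (ResidueField O) (parSp N (ResidueField O)) - finrank (ResidueField O)
      ↥(maxGenEigenspace ((heckeU 0 N (ResidueField O) hp).restrict fun _ hu ↦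
        heckeU_mem_parSp_of_mem_parSp hp hpK hp2 hpN hu) 0) =
      finrank ℂ ↥(⨆ (u : ℂ) (_ : ‖ι.symm u‖ = 1),
          (heckeT (Gamma0 N) ((0 : ℕ) + 2 : ℤ) p).maxGenEigenspace u) +
        finrank ℂ ↥(⨆ (u : ℂ) (_ : ‖(conjι ι).symm u‖ = 1),
          (heckeT (Gamma0 N) ((0 : ℕ) + 2 : ℤ) p).maxGenEigenspace u) := hV₂count
  have key := (hVcount.symm.le.trans hle).trans hR.le
  have e1 : finrank ℂ ↥(⨆ (u : ℂ) (_ : ‖ι.symm u‖ = 1),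
        (heckeT (Gamma0 N) ((0 : ℕ) + 2 : ℤ) p).maxGenEigenspace u) =
      finrank ℂ ↥(⨆ (u : ℂ) (_ : ‖ι.symm u‖ = 1), (heckeT (Gamma0 N) 2 p).maxGenEigenspace u) :=
    congrArg (fun k : ℤ ↦ finrank ℂ ↥(⨆ (u : ℂ) (_ : ‖ι.symm u‖ = 1),
      (heckeT (Gamma0 N) k p).maxGenEigenspace u)) (by norm_num)
  have e2 : finrank ℂ ↥(⨆ (u : ℂ) (_ : ‖(conjι ι).symm u‖ = 1),
        (heckeT (Gamma0 N) ((0 : ℕ) + 2 : ℤ) p).maxGenEigenspace u) =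
      finrank ℂ ↥(⨆ (u : ℂ) (_ : ‖(conjι ι).symm u‖ = 1),
        (heckeT (Gamma0 N) 2 p).maxGenEigenspace u) :=
    congrArg (fun k : ℤ ↦ finrank ℂ ↥(⨆ (u : ℂ) (_ : ‖(conjι ι).symm u‖ = 1),
      (heckeT (Gamma0 N) k p).maxGenEigenspace u)) (by norm_num)
  omega

/-- **The deep half of Hida's rank constancy**: for `p ≥ 5`, `p ∤ N`, `k ≥ 2`,
`k ≡ 2 (mod p - 1)`, the number of `p`-adic unit eigenvalues of `U_p` on `S_k(Γ₀(Np))` is at most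
the number on `S_2(Γ₀(Np))` (counted with multiplicity).  With the elementary half
(`HidaRank.hida_ordinary_rank_two_le`) this is Hida's theorem that the rank of the ordinary part is
independent of the weight. [cite: Hida1986, Thm. 3.1] [cite: Hida1986ENS, Cor. 7.2]
[cite: Hida2022EMI, Cor. 4.2.32] -/
theorem finrank_ordinary_le_two (ι : PadicAlgCl p ≃+* ℂ) (N : ℕ) [NeZero N] (hp5 : 5 ≤ p)
    (hpN : ¬ p ∣ N) (k : ℤ) (hk : 2 ≤ k) (hpk : ((p : ℤ) - 1) ∣ (k - 2)) :
    (haveI : NeZero p := ⟨(Fact.out : p.Prime).ne_zero⟩;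
      finrank ℂ ↥(⨆ (u : ℂ) (_ : ‖ι.symm u‖ = 1),
          (heckeT (Gamma0 (N * p)) k p).maxGenEigenspace u) ≤
        finrank ℂ ↥(⨆ (u : ℂ) (_ : ‖ι.symm u‖ = 1),
          (heckeT (Gamma0 (N * p)) 2 p).maxGenEigenspace u)) := by
  have hp : p.Prime := Fact.out
  haveI : NeZero (N * p) := ⟨Nat.mul_ne_zero (NeZero.ne N) hp.ne_zero⟩
  obtain ⟨n, rfl⟩ : ∃ n : ℕ, k = (n : ℤ) + 2 := ⟨(k - 2).toNat, by omega⟩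
  have hp2 : p ≠ 2 := by omega
  have hpn : (p - 1) ∣ n := by
    have h1 : ((p : ℤ) - 1) ∣ (n : ℤ) := by simpa using hpk
    have h2 : (((p - 1 : ℕ) : ℤ)) ∣ (n : ℤ) := by
      rwa [Nat.cast_sub hp.one_le, Nat.cast_one]
    exact_mod_cast h2
  have hn : Even n :=
    even_iff_two_dvd.mpr ((even_iff_two_dvd.mp (hp.even_sub_one hp2)).trans hpn)
  have H := ord_add_ord_le ι (N * p) (dvd_mul_left p N) hp5 hn hpn
  have E1 : finrank ℂ ↥(⨆ (u : ℂ) (_ : ‖ι.symm u‖ = 1),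
        (heckeT (Gamma0 (N * p)) 2 p).maxGenEigenspace u) ≤
      finrank ℂ ↥(⨆ (u : ℂ) (_ : ‖ι.symm u‖ = 1),
        (heckeT (Gamma0 (N * p)) ((n : ℤ) + 2) p).maxGenEigenspace u) :=
    HidaRank.hida_ordinary_rank_two_le p ι N hp5 hpN _ hk hpk
  have E2 : finrank ℂ ↥(⨆ (u : ℂ) (_ : ‖(conjι ι).symm u‖ = 1),
        (heckeT (Gamma0 (N * p)) 2 p).maxGenEigenspace u) ≤
      finrank ℂ ↥(⨆ (u : ℂ) (_ : ‖(conjι ι).symm u‖ = 1),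
        (heckeT (Gamma0 (N * p)) ((n : ℤ) + 2) p).maxGenEigenspace u) :=
    HidaRank.hida_ordinary_rank_two_le p (conjι ι) N hp5 hpN _ hk hpk
  show finrank ℂ ↥(⨆ (u : ℂ) (_ : ‖ι.symm u‖ = 1),
        (heckeT (Gamma0 (N * p)) ((n : ℤ) + 2) p).maxGenEigenspace u) ≤
      finrank ℂ ↥(⨆ (u : ℂ) (_ : ‖ι.symm u‖ = 1),
        (heckeT (Gamma0 (N * p)) 2 p).maxGenEigenspace u)
  omega

end Hard

end Literature.NumberTheory.EllipticCurves.ModularForms.HidaCohomology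

/-! ### `hida_exists_congruent_ordinary_newform` from the Modularity Theorem -/

namespace Literature.NumberTheory.EllipticCurves

open ModularForms

/-- **`hida_exists_congruent_ordinary_newform` follows from the Modularity Theorem**
(`exists_isNewformOf`): the deep half of Hida's rank constancy being proved
(`HidaCohomology.finrank_ordinary_le_two`), the reduction
`hida_exists_congruent_ordinary_newform_of_exists_isNewformOf_of_rank_le` applies.  No `_holds`
is claimed: `exists_isNewformOf` (Wiles, Taylor–Wiles, Breuil–Conrad–Diamond–Taylor) is not proved
in the tree. [cite: Hida1986, Thm. 1.2, Cor. 1.3] [cite: BreuilConradDiamondTaylor2001, Thm. A] -/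
theorem hida_exists_congruent_ordinary_newform_of_exists_isNewformOf (hmod : exists_isNewformOf) :
    hida_exists_congruent_ordinary_newform :=
  hida_exists_congruent_ordinary_newform_of_exists_isNewformOf_of_rank_le hmod
    fun _ _ ι N _ hp5 hpN k hk hpk ↦
      HidaCohomology.finrank_ordinary_le_two ι N hp5 hpN k hk hpk

end Literature.NumberTheory.EllipticCurves
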